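import Summits.NavierStokesRegularity.NavierStokesRegularity.Theses.AxisymmetricExtremality
import Literature.Analysis.FluidPDE.KNSSAxisymmetricNoSwirl
import Literature.Analysis.FluidPDE.BoundedRepresentative
import Literature.Analysis.FluidPDE.KatoLocalL3Exists
import Literature.Analysis.FluidPDE.SolenoidalL2Duality
import Literature.Analysis.FluidPDE.HomSobolevWeakLimits
import Literature.Analysis.FluidPDE.GavrilovLocalisation
import Literature.Analysis.FluidPDE.SereginZajaczkowski2007SwirlRotation

/-!
# Representative upgrade: an a.e.-axisymmetric minimal blow-up datum is axisymmetric

Stub `stub_aeAxisymmetricUpgrade` of the line birth for the crux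
`Summit.NavierStokesRegularity.NavierStokesRegularity.Theses.AxisymmetricExtremality.PFoldToAxisymmetric`
(item stmt-NavierStokesRegularity-15454).

A Rusin–Šverák minimal blow-up datum `(u, g)` (`IsMinimalBlowupDatum ν u g`) which is
almost-everywhere equivariant under every rotation `R_θ = rotZ θ` about the `x 2`-axis,
`u ∘ R_θ = R_θ ∘ u` a.e. for every `θ`, can be replaced by an EVERYWHERE axisymmetric minimal
blow-up datum `(u', g)` with the same `Ḣ^{1/2}` class `g`. Two folklore steps:

* `IsMinimalBlowupDatum ν · g` only depends on the a.e. class of the field: `MemLp`, `Represents`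
  and `IsWeaklyDivFree` are integral conditions, and a global Kato solution of an a.e. modification
  of the datum is re-anchored at `t = 0` (`hasGlobalKatoSolution_congr_ae`,
  `isMinimalBlowupDatum_congr_ae`).
* The circle average `u' x = (2π)⁻¹ ∫₀^{2π} R_{−θ} ũ (R_θ x) dθ` of a strongly measurable
  representative `ũ` of `u` is exactly equivariant everywhere (shift the angle, periodicity, pull
  the linear isometry `R_α` out of the Bochner integral — no integrability needed) and equals `ũ`
  almost everywhere (Fubini–Tonelli swap of "for every `θ`, for a.e. `x`").
-/

noncomputable section

set_option linter.dupNamespace false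

namespace Summit.NavierStokesRegularity.NavierStokesRegularity.Theorems.PFoldToAxisymmetric.AeAxisymmetricUpgrade

open MeasureTheory Filter Topology Set Function Real
open scoped ENNReal
open Literature.Analysis.FluidPDE Literature.Analysis.FunctionSpaces

/-! ### Part A: `IsMinimalBlowupDatum ν · g` is invariant under a.e. modification -/

/-- A global Kato solution survives an a.e. modification of the datum: re-anchor the solution at
`t = 0` (`Function.update w 0 v₀`); the duality-form mild class, `C([0,∞); L³)` and the
measurability on `(0,∞) × ℝ³` only see the a.e. classes of the slices and the open time
half-line. [folklore] -/
theorem hasGlobalKatoSolution_congr_ae {ν : ℝ}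
    {u₀ v₀ : EuclideanSpace ℝ (Fin 3) → EuclideanSpace ℝ (Fin 3)}
    (h : HasGlobalKatoSolution ν u₀) (huv : u₀ =ᵐ[volume] v₀) : HasGlobalKatoSolution ν v₀ := by
  obtain ⟨w, hmild, hcont, hw0, hmeas⟩ := h
  have hslice : ∀ t, Function.update w 0 v₀ t =ᵐ[volume] w t := by
    intro t
    rcases eq_or_ne t 0 with rfl | ht
    · rw [Function.update_self, hw0]
      exact huv.symm
    · rw [Function.update_of_ne ht]
  refine ⟨Function.update w 0 v₀, ⟨fun t ht => ?_, fun t ht => ?_⟩, ?_,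
    Function.update_self 0 v₀ w, ?_⟩
  · exact ((hmild.isMildNSSolutionOn (t + 1)).congr_ae_Ico (fun s _ => hslice s) huv.symm).1 t
      ⟨ht, lt_add_one t⟩
  · exact ((hmild.isMildNSSolutionOn (t + 1)).congr_ae_Ico (fun s _ => hslice s) huv.symm).2 t
      ⟨ht, lt_add_one t⟩
  · exact hcont.congr_ae_slices fun t _ => hslice t
  · refine hmeas.congr ?_
    filter_upwards [ae_restrict_mem (measurableSet_Ioi.prod MeasurableSet.univ)]
    rintro ⟨t, x⟩ ⟨ht, -⟩
    simp only [Function.uncurry_apply_pair]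
    rw [Function.update_of_ne (ne_of_gt ht)]

/-- **`M` is closed under a.e. modification of the field.** If `(u, g)` is a minimal blow-up datum
and `u' = u` a.e., then `(u', g)` is a minimal blow-up datum: `L³`-membership, representation by
`g`, weak divergence-freeness and (non-)existence of a global Kato solution are all invariant
under a.e. modification. [folklore] -/
theorem isMinimalBlowupDatum_congr_ae {ν : ℝ}
    {u u' : EuclideanSpace ℝ (Fin 3) → EuclideanSpace ℝ (Fin 3)}
    {g : HomSobolev (EuclideanSpace ℝ (Fin 3)) (EuclideanSpace ℂ (Fin 3)) (1 / 2 : ℝ)}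
    (h : IsMinimalBlowupDatum ν u g) (huu' : u =ᵐ[volume] u') : IsMinimalBlowupDatum ν u' g := by
  obtain ⟨hL3, hrep, hdiv, hnorm, hno⟩ := h
  exact ⟨hL3.ae_eq huu', hrep.congr_ae (huu'.fun_comp EuclideanSpace.complexify),
    hdiv.congr_ae huu', hnorm, fun hK => hno (hasGlobalKatoSolution_congr_ae hK huu'.symm)⟩

/-! ### Part B: the circle average is an exactly equivariant representative -/

/-- **The circle average.** For a strongly measurable field `ũ : ℝ³ → ℝ³` which is, for every
angle `θ`, a.e. equivariant under `R_θ`, the circle average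
`U x = (2π)⁻¹ ∫₀^{2π} R_{−θ} ũ (R_θ x) dθ` (Bochner integral, `0` where not integrable) is
equivariant under every `R_θ` at EVERY point, and `U = ũ` almost everywhere (Fubini: for a.e. `x`
the integrand is a.e. the constant `ũ x`). [folklore] -/
theorem exists_axisymmetric_representative
    {ũ : EuclideanSpace ℝ (Fin 3) → EuclideanSpace ℝ (Fin 3)} (hũm : StronglyMeasurable ũ)
    (hae : ∀ θ : ℝ, ∀ᵐ x ∂(volume : Measure (EuclideanSpace ℝ (Fin 3))),
      ũ (rotZ θ x) = rotZ θ (ũ x)) :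
    ∃ U : EuclideanSpace ℝ (Fin 3) → EuclideanSpace ℝ (Fin 3),
      U =ᵐ[volume] ũ ∧ ∀ (θ : ℝ) (x : EuclideanSpace ℝ (Fin 3)), U (rotZ θ x) = rotZ θ (U x) := by
  -- `2π`-periodicity of the rotations in the angle
  have hadd : ∀ (θ : ℝ) (y : EuclideanSpace ℝ (Fin 3)), rotZ (θ + 2 * π) y = rotZ θ y := by
    intro θ y
    ext i
    fin_cases i <;> simp [Real.cos_add_two_pi, Real.sin_add_two_pi]
  have hsub : ∀ (θ : ℝ) (y : EuclideanSpace ℝ (Fin 3)), rotZ (θ - 2 * π) y = rotZ θ y := by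
    intro θ y
    rw [← hadd (θ - 2 * π), sub_add_cancel]
  -- the integrand `F x θ = R_{−θ} ũ (R_θ x)` and the circle average `U`
  obtain ⟨F, hF⟩ : ∃ F : EuclideanSpace ℝ (Fin 3) → ℝ → EuclideanSpace ℝ (Fin 3),
      ∀ x θ, F x θ = rotZ (-θ) (ũ (rotZ θ x)) :=
    ⟨_, fun _ _ => rfl⟩
  obtain ⟨U, hU⟩ : ∃ U : EuclideanSpace ℝ (Fin 3) → EuclideanSpace ℝ (Fin 3),
      ∀ x, U x = (1 / (2 * π)) • ∫ θ in (0 : ℝ)..2 * π, F x θ :=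
    ⟨_, fun _ => rfl⟩
  have h2π : (0 : ℝ) ≤ 2 * π := Real.two_pi_pos.le
  refine ⟨U, ?_, fun α x => ?_⟩
  · -- `U = ũ` a.e.: swap "for every `θ`, for a.e. `x`" into "for a.e. `x`, for a.e. `θ`"
    have hset : MeasurableSet
        {q : ℝ × EuclideanSpace ℝ (Fin 3) | ũ (rotZ q.1 q.2) = rotZ q.1 (ũ q.2)} :=
      measurableSet_eq_fun
        (hũm.measurable.comp SereginZajaczkowski2007.continuous_rotZ_prod.measurable)
        (SereginZajaczkowski2007.continuous_rotZ_prod.measurable.comp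
          (measurable_fst.prodMk (hũm.measurable.comp measurable_snd)))
    have hswap : ∀ᵐ x ∂(volume : Measure (EuclideanSpace ℝ (Fin 3))), ∀ᵐ θ ∂(volume : Measure ℝ),
        ũ (rotZ θ x) = rotZ θ (ũ x) :=
      (Measure.ae_ae_comm (μ := (volume : Measure ℝ))
        (ν := (volume : Measure (EuclideanSpace ℝ (Fin 3))))
        (p := fun θ x => ũ (rotZ θ x) = rotZ θ (ũ x)) hset).1 (Eventually.of_forall hae)
    filter_upwards [hswap] with x hx
    have hI : (∫ θ in (0 : ℝ)..2 * π, F x θ) = ∫ _θ in (0 : ℝ)..2 * π, ũ x := by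
      refine intervalIntegral.integral_congr_ae ?_
      filter_upwards [hx] with θ hθ _
      rw [hF, hθ, Gavrilov.rotZ_neg_rotZ]
    rw [hU, hI, intervalIntegral.integral_const, smul_smul, sub_zero, one_div,
      inv_mul_cancel₀ Real.two_pi_pos.ne', one_smul]
  · -- exact equivariance: shift the angle, use periodicity, pull `R_α` out of the integral
    have hpt : F (rotZ α x) = fun θ => rotZLIE α (F x (θ + α)) := by
      funext θ
      rw [hF, hF, rotZLIE_apply, ← rotZ_add α (-(θ + α)), ← rotZ_add θ α]
      congr 1
      ring
    have hper : Function.Periodic (F x) (2 * π) := fun θ => by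
      rw [hF, hF, hadd, neg_add', hsub]
    have hshift : (∫ θ in (0 : ℝ)..2 * π, F x (θ + α)) = ∫ θ in (0 : ℝ)..2 * π, F x θ := by
      rw [intervalIntegral.integral_comp_add_right, zero_add, add_comm (2 * π) α,
        hper.intervalIntegral_add_eq α 0, zero_add]
    have hcomm : (∫ θ in (0 : ℝ)..2 * π, rotZLIE α (F x (θ + α))) =
        rotZLIE α (∫ θ in (0 : ℝ)..2 * π, F x (θ + α)) := by
      rw [intervalIntegral.integral_of_le h2π, intervalIntegral.integral_of_le h2π]
      exact (rotZLIE α).toLinearIsometry.integral_comp_comm _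
    calc U (rotZ α x) = (1 / (2 * π)) • ∫ θ in (0 : ℝ)..2 * π, rotZLIE α (F x (θ + α)) := by
          rw [hU, hpt]
      _ = rotZLIE α (U x) := by
          rw [hcomm, hshift, hU, (rotZLIE α).map_smul]
      _ = rotZ α (U x) := rfl

/-! ### The stub -/

/-- **Stub 4 (representative upgrade).** A minimal blow-up datum which is almost-everywhere
equivariant under every rotation `R_θ` about the `x 2`-axis can be replaced by an EVERYWHERE
axisymmetric minimal blow-up datum: `IsMinimalBlowupDatum ν · g` is invariant under
a.e.-modification of the field, and the circle average `x ↦ ⨍ R_{−θ} u (R_θ x) dθ` (zero where not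
integrable) is an exactly equivariant representative of the a.e.-class of `u`. [folklore] -/
theorem stub_aeAxisymmetricUpgrade :
    ∀ (ν : ℝ) (u : EuclideanSpace ℝ (Fin 3) → EuclideanSpace ℝ (Fin 3))
      (g : Literature.Analysis.FunctionSpaces.HomSobolev (EuclideanSpace ℝ (Fin 3))
        (EuclideanSpace ℂ (Fin 3)) (1 / 2 : ℝ)),
      Literature.Analysis.FluidPDE.IsMinimalBlowupDatum ν u g →
      (∀ θ : ℝ,
        (fun x : EuclideanSpace ℝ (Fin 3) =>
          u (WithLp.toLp 2 ![Real.cos θ * x 0 - Real.sin θ * x 1,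
            Real.sin θ * x 0 + Real.cos θ * x 1, x 2])) =ᵐ[volume]
        fun x => WithLp.toLp 2 ![Real.cos θ * u x 0 - Real.sin θ * u x 1,
          Real.sin θ * u x 0 + Real.cos θ * u x 1, u x 2]) →
      ∃ (u' : EuclideanSpace ℝ (Fin 3) → EuclideanSpace ℝ (Fin 3))
        (g' : Literature.Analysis.FunctionSpaces.HomSobolev (EuclideanSpace ℝ (Fin 3))
          (EuclideanSpace ℂ (Fin 3)) (1 / 2 : ℝ)),
        Literature.Analysis.FluidPDE.IsMinimalBlowupDatum ν u' g' ∧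
        ∀ (θ : ℝ) (x : EuclideanSpace ℝ (Fin 3)),
          u' (WithLp.toLp 2 ![Real.cos θ * x 0 - Real.sin θ * x 1,
            Real.sin θ * x 0 + Real.cos θ * x 1, x 2]) =
          WithLp.toLp 2 ![Real.cos θ * u' x 0 - Real.sin θ * u' x 1,
            Real.sin θ * u' x 0 + Real.cos θ * u' x 1, u' x 2] := by
  intro ν u g hmin hae
  -- the hypothesis in `rotZ` language (definitional)
  have hae' : ∀ θ : ℝ,
      (fun x : EuclideanSpace ℝ (Fin 3) => u (rotZ θ x)) =ᵐ[volume] fun x => rotZ θ (u x) := hae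
  -- a strongly measurable representative `ũ` of the `L³` field `u`
  obtain ⟨ũ, hũm, huũ⟩ : ∃ ũ : EuclideanSpace ℝ (Fin 3) → EuclideanSpace ℝ (Fin 3),
      StronglyMeasurable ũ ∧ u =ᵐ[volume] ũ :=
    ⟨_, hmin.1.aestronglyMeasurable.stronglyMeasurable_mk, hmin.1.aestronglyMeasurable.ae_eq_mk⟩
  -- `ũ` is a.e. equivariant under every `R_θ` (rotations preserve Lebesgue measure)
  have hae2 : ∀ θ : ℝ, ∀ᵐ x ∂(volume : Measure (EuclideanSpace ℝ (Fin 3))),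
      ũ (rotZ θ x) = rotZ θ (ũ x) := fun θ => by
    have e1 : (fun x : EuclideanSpace ℝ (Fin 3) => u (rotZ θ x)) =ᵐ[volume]
        fun x => ũ (rotZ θ x) :=
      (measurePreserving_rotZ θ).quasiMeasurePreserving.ae_eq huũ
    filter_upwards [hae' θ, e1, huũ] with x h1 h2 h3
    rw [← h2, h1, h3]
  -- the circle average of `ũ`
  obtain ⟨U, hUũ, hUeq⟩ := exists_axisymmetric_representative hũm hae2
  exact ⟨U, g, isMinimalBlowupDatum_congr_ae hmin (huũ.trans hUũ.symm), fun θ x => hUeq θ x⟩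

end Summit.NavierStokesRegularity.NavierStokesRegularity.Theorems.PFoldToAxisymmetric.AeAxisymmetricUpgrade

end
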